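import Summits.Parity.GeneralizedHardyLittlewood.Theses.FordMaynardSieveConst01651

/-!
# Refutation of `FordMaynardSieveConst01651.GCert01651` (item stmt-Parity-19186)

Class: **refuted-misstated**. The crux `GCert01651` transcribes the support clause of a Ford–Maynard
`𝒮𝒢₁`-certificate with a STRICT inequality, `g k x ≠ 0 → k = 0 ∨ ((∀ i, 0.1651 < x i) ∧ ∑ i, x i < 1 / 2)`,
where the printed source has the closed condition: Ford–Maynard, arXiv:2407.14368, (7.1) p. 27
("`|x| + ψ(x) ≤ γ`", here `γ = 1/2`, `ψ = 0`) and §8.2 p. 47 ("sum of components at most `1/2`",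
`g(x) = −𝟙(x ≤ 1/2)`). With the strict clause the sign condition `(𝟙⋆g)(x) ≤ 0` on the slice
`{∑ xᵢ = 1, 0.1651 < xᵢ < 0.8349}` fails at the closed point `x = (1/2, 1/2)`: every non-empty subvector
of `x` has coordinate sum `≥ 1/2`, so `g` vanishes on it and `(𝟙⋆g)(x) = g(∅) = 1 > 0`. Hence NO `g`
satisfies the clause set, whatever the value of `V(0.1651, g)`.

Repaired statement `C′` (believed meaningful, = the LP-improvement claim the route intends): `GCert01651`
with `∑ i, x i ≤ 1 / 2` in place of `∑ i, x i < 1 / 2`. The witness `(1/2, 1/2)` MISSES `C′` (there the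
one-coordinate subvectors `(1/2)` may carry `g₁(1/2) < 0`). The same one-character slip makes the named
Literature fact `FordMaynard2024_thm73a_levelHalf` (hence the route's support item `FMThm73aLevelHalf`)
vacuously true; its restatement with `≤` is filed separately by the route writer.

First observed by planner-linewriter-parity-smallroutes-1 (Cruxes/FMThm73aLevelHalf/Lines/closed_point.lean);
this file is an independent, self-contained kernel proof (no import of that workfile).
-/

namespace Summit.Parity.GeneralizedHardyLittlewood.Theorems

open Finset Literature.NumberTheory.Sieve Literature.NumberTheory.Sieve.FordMaynard

/-- Refutes `FordMaynardSieveConst01651.GCert01651` [refuted-misstated]: no vector function `g` with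
`g(∅) = 1` whose support clause is typed with the STRICT sum condition `∑ xᵢ < 1/2` can satisfy the sign
condition `(𝟙⋆g)(x) ≤ 0` on the slice `∑ xᵢ = 1`, `0.1651 < xᵢ < 0.8349`; witness `x = (1/2, 1/2) ∈ ℝ²`,
where `(𝟙⋆g)(x) = g(∅) = 1`. Repaired: replace `∑ i, x i < 1 / 2` by `∑ i, x i ≤ 1 / 2` (Ford–Maynard
(7.1), closed support); the witness misses the repaired statement.
[cite: FordMaynard2024PrimeSieves, (7.1) p. 27 and §8.2 p. 47] -/
theorem FordMaynardSieveConst01651GCert01651_refuted :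
    ¬ Summit.Parity.GeneralizedHardyLittlewood.Theses.FordMaynardSieveConst01651.GCert01651 := by
  classical
  rintro ⟨g, -, -, h0, hsupp, hH, -⟩
  have hx : ∀ i : Fin 2, (1651 / 10000 : ℝ) < (fun _ : Fin 2 => (1 / 2 : ℝ)) i ∧
      (fun _ : Fin 2 => (1 / 2 : ℝ)) i < 1 - 1651 / 10000 := fun _ => ⟨by norm_num, by norm_num⟩
  have hs : ∑ i : Fin 2, (fun _ : Fin 2 => (1 / 2 : ℝ)) i = 1 := by
    simp only [Finset.sum_const, Finset.card_univ, Fintype.card_fin, nsmul_eq_mul]; norm_num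
  have h := hH 2 le_rfl (fun _ => (1 / 2 : ℝ)) hx hs
  -- every nonempty subvector of (1/2,1/2) has coordinate sum ≥ 1/2, hence `g` vanishes on it
  have hvan : ∀ A : Finset (Fin 2), A ≠ ∅ →
      g A.card (fun i => (fun _ : Fin 2 => (1 / 2 : ℝ)) (A.orderEmbOfFin rfl i)) = 0 := by
    intro A hA
    by_contra hne
    rcases hsupp _ _ hne with hk | ⟨-, hlt⟩
    · exact hA (Finset.card_eq_zero.1 hk)
    · simp only [Finset.sum_const, Finset.card_univ, Fintype.card_fin, nsmul_eq_mul] at hlt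
      have : (1 : ℝ) ≤ A.card := by
        exact_mod_cast Finset.card_pos.2 (Finset.nonempty_iff_ne_empty.2 hA)
      linarith
  have hval : starSum g 2 (fun _ => (1 / 2 : ℝ)) = 1 := by
    unfold starSum
    rw [← Finset.add_sum_erase _ _ (Finset.mem_univ (∅ : Finset (Fin 2)))]
    have hrest : ∑ A ∈ (Finset.univ : Finset (Finset (Fin 2))).erase ∅,
        g A.card (fun i => (fun _ : Fin 2 => (1 / 2 : ℝ)) (A.orderEmbOfFin rfl i)) = 0 :=
      Finset.sum_eq_zero fun A hA => hvan A (Finset.mem_erase.1 hA).1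
    rw [hrest, add_zero]
    exact h0 _
  rw [hval] at h
  norm_num at h

end Summit.Parity.GeneralizedHardyLittlewood.Theorems
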